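import Summits.BirchSwinnertonDyer.BirchSwinnertonDyer.Theorems.GenusKolyvaginAtTwoEquivariantKolyvaginExactAtTwoLocalDualityOrder
import HarnessLib

/-!
# `𝓛_v^⊥ = 𝓛_v` off `p`, unconditionally (local Tate duality for `E`, perfectness form)

Crux `EquivariantKolyvaginExactAtTwo` (Q3, stmt-BirchSwinnertonDyer-24882), stub **S3** (memo
`Q3-KERNEL-EIGEN-v2` §2), sequel to `…LocalDualityOrder.lean`: with the Euler characteristic count
`#H¹(K_v, E[p^k]) = #E(K_v)[p^k]²` proved there UNCONDITIONALLY at places `v ∤ p`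
(`LocalDualityOrder.hEuler_of_not_mem`), the tree's
`forall_mem_kummerLocalConditionAt_weilCupProduct_eq_zero_iff_of_eulerChar` (Milne, *ADT*, I Cor. 3.4
/ the local input of Lemma 6.15; Poonen–Rains 2012, Prop. 4.10: the local Kummer condition is
maximal isotropic for the Weil cup product) becomes unconditional off `p`. This is the PERFECTNESS
half of McCallum 1991, Lemma 5.3 ("`y ∈ E(K_λ)/p^M` and `d ∈ H¹(K_λ, E)_{p^M}` pair non-trivially…")
in the tree's currency, at every place prime to `p` — in particular at the Gross–Kolyvagin primes
`ℓ ≠ 2` of the `p = 2` descent. Kept in its own file because the cup product needs the local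
instance `absoluteGaloisGroup_compactSpace` (as in all the tree's local-duality files).

BSD is not proved by this file.

## References

* [MilneADT2006] J. S. Milne, *Arithmetic Duality Theorems*, 2nd ed., Ch. I, Cor. 3.4, Lemma 6.15.
* [PoonenRains2012] B. Poonen, E. Rains, *Random maximal isotropic subspaces and Selmer groups*,
  JAMS 25 (2012), Prop. 4.10.
* [McCallumLMS1991] W. G. McCallum, *Kolyvagin's work on Shafarevich–Tate groups*, LMS LN 153
  (1991), §5 Lemma 5.3.
-/

noncomputable section

open scoped Classical

universe u

namespace Summit.BirchSwinnertonDyer.BirchSwinnertonDyer.Theorems.GenusExact.LocalDualityOrder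

open CategoryTheory Function
open _root_.WeierstrassCurve Field NumberField IsDedekindDomain
open Literature.NumberTheory.EllipticCurves
open Literature.NumberTheory.GaloisRepresentations
open scoped ContRepresentation

-- Cup products need `LocallyCompactSpace Γ_F`; as in the tree's local-duality files
-- (`LocalTateDualityOrderForE`, `LocalEulerCharacteristicTorsion`), the compactness of absolute
-- Galois groups is a local instance only.
attribute [local instance] absoluteGaloisGroup_compactSpace

variable {K : Type u} [Field K] [NumberField K] (v : HeightOneSpectrum (𝓞 K))
variable (W : WeierstrassCurve K) [W.IsElliptic]

/-- **`𝓛_v^⊥ = 𝓛_v` off `p`, unconditionally**: for a non-degenerate alternating `Γ_K`-equivariant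
`μ_{p^k}`-valued `e` on `E[p^k]` (a Weil pairing) and `x ∈ H¹(K_v, E[p^k])` at a place `v ∤ p`,
`(∀ y ∈ 𝓛_v, x ∪ₑ y = 0) ↔ x ∈ 𝓛_v` — the local Kummer condition is its own annihilator (Tate local
duality for `E`, Milne I Cor. 3.4 / the local input of Lemma 6.15; Poonen–Rains Prop. 4.10): the
tree's `…_iff_of_eulerChar` fed with `hEuler_of_not_mem`. [cite: MilneADT2006, Ch. I, Cor. 3.4 and Lemma 6.15]
[cite: PoonenRains2012, Prop. 4.10] -/
theorem forall_mem_kummerLocalConditionAt_weilCupProduct_eq_zero_iff_of_not_mem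
    {p : ℕ} [Fact p.Prime] {k : ℕ} [NeZero (p ^ k)] (hk : k ≠ 0) (hpv : (p : 𝓞 K) ∉ v.asIdeal)
    (e : geomTorsion W ((p ^ k : ℕ) : ℤ) → geomTorsion W ((p ^ k : ℕ) : ℤ) → AlgebraicClosure K)
    (hμ : ∀ S T, e S T ^ (p ^ k) = 1)
    (hadd₁ : ∀ S₁ S₂ T, e (S₁ + S₂) T = e S₁ T * e S₂ T)
    (hadd₂ : ∀ S T₁ T₂, e S (T₁ + T₂) = e S T₁ * e S T₂)
    (hgal : ∀ (σ : absoluteGaloisGroup K) (S T : geomTorsion W ((p ^ k : ℕ) : ℤ)),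
      σ • e S T = e (σ • S) (σ • T))
    (halt : ∀ T, e T T = 1) (hnondeg : ∀ T, (∀ S, e S T = 1) → T = 0)
    (x : galoisCohomology
      (GaloisRep.restrictField (v.adicCompletion K) (W.torsionGaloisModule ((p ^ k : ℕ) : ℤ))) 1) :
    (∀ y ∈ W.kummerLocalConditionAt ((p ^ k : ℕ) : ℤ) (v.adicCompletion K),
        ((weilContPairing W (p ^ k) e hμ hadd₁ hadd₂ hgal).restrict
          (absGaloisRestrict K (v.adicCompletion K))).cupProduct x y = 0) ↔
      x ∈ W.kummerLocalConditionAt ((p ^ k : ℕ) : ℤ) (v.adicCompletion K) :=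
  forall_mem_kummerLocalConditionAt_weilCupProduct_eq_zero_iff_of_eulerChar W v (p ^ k) e hμ hadd₁
    hadd₂ hgal halt hnondeg (hEuler_of_not_mem v W hk hpv) x


end Summit.BirchSwinnertonDyer.BirchSwinnertonDyer.Theorems.GenusExact.LocalDualityOrder

end
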